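import Summits.HodgeConjecture.HodgeConjecture.Theorems.K2LiuDoubledThetaPairingContinuous
import HarnessLib

/-!
# The doubling pairing of the doubled line-theta lift is linear in `Φ`: reduction of the non-vanishing hypothesis of socket #44∕45R from a SPAN
# to a GENERATOR — organ (O45ii′) (assembly Step 1′, `K2/K2Liu-p03/g3/ROAD-44-45R-Assembly`)

Track B ∕ hLiu418 = stmt-HodgeConjecture-24832, line `K2_Liu_CurveThetaSigs`, unit U6, socket #44∕45R `sig_K2LiuUndoublingSeparation` (ED. 7: the hypothesis'
`Φ′` lies in the `ℂ`-span of the pure tensors `Φ₁ ⊠_ι Φ₂`, LEAD F0P6-plan ruling 2026-09-04 01:42Z (b)); seat `hodgecm-mathlib-K2Liu-p03` (g3).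
Since `Φ ↦ doublingPairing μ (toQuotFun₂ (g ↦ Θ̃_Φ(f)(ι(ιA g₁, ιA g₂)))) w₁ w₂` is `ℂ`-LINEAR (the kernel is linear in `Φ` — Weil's theta distribution is
linear, ★ `lineThetaKernelDatum_thetaLinear`, and the `q`-integral over the compact `[U(⟨a′⟩)]` of a continuous slice is additive, ★
`K2LiuThetaKernelSliceIntegral.integrable_thetaKer_slice` — and the pairing is additive over CONTINUOUS kernels on the compact `[G]²` against `L¹` weights, ★
`K2LiuDoublingPairingContinuous.integrable_kernel_mul_weights`, ★ `K2LiuDoubledThetaPairingContinuous.continuous_toQuotFun₂_doubledLineThetaLift`), a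
non-zero pairing at some `Φ′ ∈ span s` forces a non-zero pairing at some GENERATOR `T ∈ s`:

* §0 `exists_mem_of_map_span_ne_zero` — an additive homogeneous `ℓ : V → ℂ` non-zero somewhere on `span s` is non-zero somewhere on `s`;
* §1 `doubledLineThetaLift_add ∕ _smul` — ★ D8 `doubledLineThetaLift` is additive and homogeneous in `Φ` (pointwise on `H(𝔸)`);
* §2 `doublingPairing_add_of_continuous ∕ doublingPairing_const_mul` — ★ D4 `doublingPairing` is additive over continuous kernels (`[G]` compact, `μ` finite,
  `w₁, w₂ ∈ L¹(μ)`) and homogeneous;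
* §3 **`exists_mem_doublingPairing_doubledLineThetaLift_ne_zero`** — the socket's reduction: `Φ′ ∈ span s`, pairing at `Φ′` non-zero ⇒ pairing at some `T ∈ s`
  non-zero. [cite: HarrisKudlaSweet1996, §1 proof of Lem. 1.1] [cite: Weil1964, Chap. III n° 41 Thm 6 p. 193]

No definition, no instance, no named fact, no `sorry`; axioms ⊆ {propext, Classical.choice, Quot.sound}.

## References
* [HarrisKudlaSweet1996] M. Harris, S. Kudla, W. J. Sweet, J. AMS 9 (1996), §1 proof of Lem. 1.1 p. 953.
* [Weil1964] A. Weil, Acta Math. 111 (1964), Chap. III n° 41 Thm 6 p. 193.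
* [Liu2021] Y. Liu, Camb. J. Math. 9 (2021), App. B (B.7) p. 104, Lem. B.11.

HONEST LABEL: HC_CM is proved only modulo the 7 printed citations (2 remaining named inputs: hLiu418 = stmt-HodgeConjecture-24832, h413 =
stmt-HodgeConjecture-24833) until rung 0 closes; this helper moves no counter.
-/

noncomputable section

set_option autoImplicit false

set_option linter.dupNamespace false

open NumberField MeasureTheory IsDedekindDomain Filter Set
open scoped Matrix Topology Classical

namespace Summit.HodgeConjecture.HodgeConjecture.Cruxes.HLiu418.K2LiuDoubledLiftSpanReduction

open Literature.NumberTheory.Automorphic Literature.NumberTheory.Automorphic.UnitaryGroup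
open Literature.NumberTheory.Automorphic.IdeleClassGroup
open Literature.NumberTheory.Automorphic.Liu2021
open Literature.NumberTheory.Automorphic.Liu2021.Def411WeilCarriers
open Literature.NumberTheory.Automorphic.Liu2021.Def411WeilCarriersDoubling
open Literature.NumberTheory.GelbartRogawski1991 Literature.NumberTheory.GelbartRogawski1991.UnitaryDualPair
open Literature.NumberTheory.GelbartRogawski1991.GRConstruction
open Literature.NumberTheory.Weil1964
open Literature.RepresentationTheory.Liu2021
open Literature.RepresentationTheory.HeisenbergGroup
open Literature.NumberTheory.K2Lit.DoubledLineTheta Literature.NumberTheory.K2Lit.SiegelDoubled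
open Summit.HodgeConjecture.HodgeConjecture.Cruxes.HLiu418.K2LiuDoublingPairingContinuous
open Summit.HodgeConjecture.HodgeConjecture.Cruxes.HLiu418.K2LiuThetaKernelSliceIntegral
open Summit.HodgeConjecture.HodgeConjecture.Cruxes.HLiu418.K2LiuDoubledThetaPairingContinuous

/-! ## §0 Additive homogeneous functionals on a span -/

/-- **A `ℂ`-linear functional that is non-zero at a point of `span s` is non-zero at a point of `s`** (`span s ≤ ker ℓ` otherwise). [folklore] -/
theorem exists_mem_of_map_span_ne_zero {V : Type*} [AddCommGroup V] [Module ℂ V] (ℓ : V → ℂ)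
    (hadd : ∀ x y, ℓ (x + y) = ℓ x + ℓ y) (hsmul : ∀ (c : ℂ) (x : V), ℓ (c • x) = c * ℓ x)
    {s : Set V} {x : V} (hx : x ∈ Submodule.span ℂ s) (hℓ : ℓ x ≠ 0) : ∃ y ∈ s, ℓ y ≠ 0 := by
  by_contra h
  have h' : ∀ y ∈ s, ℓ y = 0 := fun y hy => by
    by_contra hy'
    exact h ⟨y, hy, hy'⟩
  let Λ : V →ₗ[ℂ] ℂ := { toFun := ℓ, map_add' := hadd, map_smul' := hsmul }
  have hle : Submodule.span ℂ s ≤ LinearMap.ker Λ := Submodule.span_le.mpr fun y hy =>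
    show Λ y = 0 from h' y hy
  exact hℓ (show ℓ x = 0 from LinearMap.mem_ker.mp (hle hx))

/-! ## §1 The doubled line-theta lift is linear in `Φ` -/

section Lift

variable (L : Type) [Field L] [NumberField L] [IsCMField L]
variable {N n : ℕ} (e : Fin N × Fin 1 ≃ Fin n)
  (dV : Fin N → L) (hdV : ∀ i, IsCMField.complexConj L (dV i) = dV i)
  (dW : Fin 1 → L) (hdW : ∀ i, IsCMField.complexConj L (dW i) = dW i)
  {n'' : ℕ} (e₁ : Fin (n + n) × Fin 1 ≃ Fin n'')
  (hdV0 : ∀ i, dV i ≠ 0) (hdW0 : ∀ i, dW i ≠ 0)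
  (lam : IdeleClassGroup L →ₜ* Circle) (hlam : IsConjugateSymplectic L lam) (a' : (Fp L)ˣ)
  (hρ : HasThetaMajorants fun
      (p : ↥(UnitaryGroup.adelic (Fp L) L (IsCMField.complexConj L) (n + n) (Matrix.diagonal (dD L e dV hdV dW hdW))) ×
        ↥(UnitaryGroup.adelic (Fp L) L (IsCMField.complexConj L) 1 (JW (Fp L) L a')))
      (Φ : piSchwartzBruhat (Fp L) (Fin n'')) =>
        pairRep (Fp L) L (IsCMField.complexConj L) (n + n) 1 e₁ (Matrix.diagonal (dD L e dV hdV dW hdW)) (JW (Fp L) L a')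
          (chiSplittingLine L e₁ (dD L e dV hdV dW hdW) (dD_conj L e dV hdV dW hdW) (dD_ne_zero L e dV hdV dW hdW hdV0 hdW0)
            (toHeckeCharacter L lam) (isUnitary_toHeckeCharacter L lam)
            ((isOscillatorChar_toHeckeCharacter_iff lam).mpr hlam) (TW (Fp L) a')
            (isUnit_det_TW (Fp L) a') (JW (Fp L) L a') (JW_eq (Fp L) L a'))
          p Φ)
  [MeasurableSpace (↥(UnitaryGroup.adelic (Fp L) L (IsCMField.complexConj L) 1 (JW (Fp L) L a')) ⧸
    (UnitaryGroup.toAdelic (Fp L) L (IsCMField.complexConj L) 1 (JW (Fp L) L a')).range)]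
  [BorelSpace (↥(UnitaryGroup.adelic (Fp L) L (IsCMField.complexConj L) 1 (JW (Fp L) L a')) ⧸
    (UnitaryGroup.toAdelic (Fp L) L (IsCMField.complexConj L) 1 (JW (Fp L) L a')).range)]
  (μW : Measure (↥(UnitaryGroup.adelic (Fp L) L (IsCMField.complexConj L) 1 (JW (Fp L) L a')) ⧸
    (UnitaryGroup.toAdelic (Fp L) L (IsCMField.complexConj L) 1 (JW (Fp L) L a')).range)) [IsFiniteMeasure μW]
  (f : C(↥(UnitaryGroup.adelic (Fp L) L (IsCMField.complexConj L) 1 (JW (Fp L) L a')) ⧸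
    (UnitaryGroup.toAdelic (Fp L) L (IsCMField.complexConj L) 1 (JW (Fp L) L a')).range, ℂ))

/-- **`Θ̃_{Φ+Ψ}(f) = Θ̃_Φ(f) + Θ̃_Ψ(f)`** pointwise on `H(𝔸)` (★ `thetaKer_add` for the theta-linear ★ `lineThetaKernelDatum`; both weighted slices are
integrable on the compact `[U(⟨a′⟩)]`, ★ `integrable_thetaKer_slice`). [cite: Weil1964, Chap. III n° 41 Thm 6 p. 193] [cite: Liu2021, App. B (B.7) p. 104] -/
theorem doubledLineThetaLift_add (Φ Ψ : piSchwartzBruhat (Fp L) (Fin n'')) (h : HA L e dV hdV dW hdW) :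
    doubledLineThetaLift L e dV hdV dW hdW e₁ hdV0 hdW0 lam hlam a' hρ μW (Φ + Ψ) f h =
      doubledLineThetaLift L e dV hdV dW hdW e₁ hdV0 hdW0 lam hlam a' hρ μW Φ f h +
        doubledLineThetaLift L e dV hdV dW hdW e₁ hdV0 hdW0 lam hlam a' hρ μW Ψ f h := by
  haveI := compactSpace_quotient_range_toAdelic_JW L a'
  set M := lineThetaKernelDatum L (n + n) e₁ (dD L e dV hdV dW hdW) (dD_conj L e dV hdV dW hdW)
    (dD_ne_zero L e dV hdV dW hdW hdV0 hdW0) lam hlam a' hρ with hM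
  have hlin : WeilThetaDatum.ThetaLinear (SX := ↥(piSchwartzBruhat (Fp L) (Fin n''))) M.W :=
    lineThetaKernelDatum_thetaLinear L (n + n) e₁ (dD L e dV hdV dW hdW) (dD_conj L e dV hdV dW hdW)
      (dD_ne_zero L e dV hdV dW hdW hdV0 hdW0) lam hlam a' hρ
  -- the generic lemma at `SX := 𝒮(𝔸^{n″})` with the theta-initial topology supplied explicitly (the `Module ℂ` instance of the type synonym
  -- `ThetaTop` is not found by instance synthesis; cf. ★ `ThetaLiftFromLinePureTensor.toQuotFun_lineThetaLift_add_left`)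
  have key : M.thetaKer (Φ + Ψ) = M.thetaKer Φ + M.thetaKer Ψ :=
    @ThetaKernelDatum.thetaKer_add _ (↥(piSchwartzBruhat (Fp L) (Fin n''))) _ _ (WeilThetaDatum.instTopologicalSpaceThetaTop _)
      _ _ _ _ _ _ _ _ _ _ M _ _ hlin Φ Ψ
  rw [doubledLineThetaLift_apply, doubledLineThetaLift_apply, doubledLineThetaLift_apply, ← hM,
    ← integral_add (integrable_thetaKer_slice M μW f Φ _) (integrable_thetaKer_slice M μW f Ψ _)]
  refine integral_congr_ae (Eventually.of_forall fun q => ?_)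
  beta_reduce
  rw [key, ContinuousMap.add_apply, mul_add]

omit [BorelSpace (↥(UnitaryGroup.adelic (Fp L) L (IsCMField.complexConj L) 1 (JW (Fp L) L a')) ⧸
    (UnitaryGroup.toAdelic (Fp L) L (IsCMField.complexConj L) 1 (JW (Fp L) L a')).range)] [IsFiniteMeasure μW] in
/-- **`Θ̃_{c•Φ}(f) = c · Θ̃_Φ(f)`** pointwise on `H(𝔸)` (★ `thetaKer_smul`). [cite: Weil1964, Chap. III n° 41 Thm 6 p. 193] [cite: Liu2021, App. B (B.7) p. 104] -/
theorem doubledLineThetaLift_smul (c : ℂ) (Φ : piSchwartzBruhat (Fp L) (Fin n'')) (h : HA L e dV hdV dW hdW) :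
    doubledLineThetaLift L e dV hdV dW hdW e₁ hdV0 hdW0 lam hlam a' hρ μW (c • Φ) f h =
      c * doubledLineThetaLift L e dV hdV dW hdW e₁ hdV0 hdW0 lam hlam a' hρ μW Φ f h := by
  set M := lineThetaKernelDatum L (n + n) e₁ (dD L e dV hdV dW hdW) (dD_conj L e dV hdV dW hdW)
    (dD_ne_zero L e dV hdV dW hdW hdV0 hdW0) lam hlam a' hρ with hM
  have hlin : WeilThetaDatum.ThetaLinear (SX := ↥(piSchwartzBruhat (Fp L) (Fin n''))) M.W :=
    lineThetaKernelDatum_thetaLinear L (n + n) e₁ (dD L e dV hdV dW hdW) (dD_conj L e dV hdV dW hdW)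
      (dD_ne_zero L e dV hdV dW hdW hdV0 hdW0) lam hlam a' hρ
  have key : M.thetaKer (c • Φ) = c • M.thetaKer Φ :=
    @ThetaKernelDatum.thetaKer_smul _ (↥(piSchwartzBruhat (Fp L) (Fin n''))) _ _ (WeilThetaDatum.instTopologicalSpaceThetaTop _)
      _ _ _ _ _ _ _ _ _ _ M _ _ hlin c Φ
  rw [doubledLineThetaLift_apply, doubledLineThetaLift_apply, ← hM, ← integral_const_mul]
  refine integral_congr_ae (Eventually.of_forall fun q => ?_)
  beta_reduce
  rw [key, ContinuousMap.smul_apply, smul_eq_mul]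
  ring

end Lift

/-! ## §2 The doubling pairing is linear in the kernel -/

section Pairing

variable {K : Type} [Field K] [NumberField K] (𝒢 : AdelicGroupData.{0} K) (μ : Measure 𝒢.automorphicQuotient)

/-- **`doublingPairing μ (K₁ + K₂) w₁ w₂ = doublingPairing μ K₁ w₁ w₂ + doublingPairing μ K₂ w₁ w₂`** for CONTINUOUS kernels on the compact `[G]²`
(`[G]` second countable), `μ` finite, `w₁, w₂ ∈ L¹(μ)` (both integrands are integrable, ★ `integrable_kernel_mul_weights`). [cite: HarrisKudlaSweet1996, §1 proof of Lem. 1.1] -/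
theorem doublingPairing_add_of_continuous [CompactSpace 𝒢.automorphicQuotient] [SecondCountableTopology 𝒢.automorphicQuotient]
    {K₁ K₂ : 𝒢.automorphicQuotient × 𝒢.automorphicQuotient → ℂ} (hK₁ : Continuous K₁) (hK₂ : Continuous K₂)
    {w₁ w₂ : 𝒢.automorphicQuotient → ℂ} (hw₁ : Integrable w₁ μ) (hw₂ : Integrable w₂ μ) :
    doublingPairing 𝒢 μ (fun x => K₁ x + K₂ x) w₁ w₂ = doublingPairing 𝒢 μ K₁ w₁ w₂ + doublingPairing 𝒢 μ K₂ w₁ w₂ := by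
  obtain ⟨C₁, hC₁⟩ := (isCompact_univ.image hK₁).isBounded.exists_norm_le
  obtain ⟨C₂, hC₂⟩ := (isCompact_univ.image hK₂).isBounded.exists_norm_le
  have h₁ := integrable_kernel_mul_weights 𝒢 μ hK₁.aestronglyMeasurable (C := C₁) (fun x => hC₁ _ (mem_image_of_mem _ (mem_univ x))) hw₁ hw₂
  have h₂ := integrable_kernel_mul_weights 𝒢 μ hK₂.aestronglyMeasurable (C := C₂) (fun x => hC₂ _ (mem_image_of_mem _ (mem_univ x))) hw₁ hw₂
  unfold doublingPairing
  rw [← integral_add h₁ h₂]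
  refine integral_congr_ae (Eventually.of_forall fun x => ?_)
  ring

/-- **`doublingPairing μ (c · K) w₁ w₂ = c · doublingPairing μ K w₁ w₂`** (no hypotheses). [cite: Liu2021, Lem. B.11 p. 102] -/
theorem doublingPairing_const_mul (c : ℂ) (Kf : 𝒢.automorphicQuotient × 𝒢.automorphicQuotient → ℂ) (w₁ w₂ : 𝒢.automorphicQuotient → ℂ) :
    doublingPairing 𝒢 μ (fun x => c * Kf x) w₁ w₂ = c * doublingPairing 𝒢 μ Kf w₁ w₂ := by
  unfold doublingPairing
  rw [← integral_const_mul]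
  refine integral_congr_ae (Eventually.of_forall fun x => ?_)
  ring

end Pairing

/-! ## §3 The socket's reduction: from a span to a generator -/

section Socket

variable (L : Type) [Field L] [NumberField L] [IsCMField L]
variable {N n : ℕ} (e : Fin N × Fin 1 ≃ Fin n) (H : Matrix (Fin N) (Fin N) L)
  (dV : Fin N → L) (hdV : ∀ i, IsCMField.complexConj L (dV i) = dV i)
  (dW : Fin 1 → L) (hdW : ∀ i, IsCMField.complexConj L (dW i) = dW i)
  {n'' : ℕ} (e₁ : Fin (n + n) × Fin 1 ≃ Fin n'')
  (hdV0 : ∀ i, dV i ≠ 0) (hdW0 : ∀ i, dW i ≠ 0)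
  (lam : IdeleClassGroup L →ₜ* Circle) (hlam : IsConjugateSymplectic L lam) (a' : (Fp L)ˣ)
  (hρ : HasThetaMajorants fun
      (p : ↥(UnitaryGroup.adelic (Fp L) L (IsCMField.complexConj L) (n + n) (Matrix.diagonal (dD L e dV hdV dW hdW))) ×
        ↥(UnitaryGroup.adelic (Fp L) L (IsCMField.complexConj L) 1 (JW (Fp L) L a')))
      (Φ : piSchwartzBruhat (Fp L) (Fin n'')) =>
        pairRep (Fp L) L (IsCMField.complexConj L) (n + n) 1 e₁ (Matrix.diagonal (dD L e dV hdV dW hdW)) (JW (Fp L) L a')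
          (chiSplittingLine L e₁ (dD L e dV hdV dW hdW) (dD_conj L e dV hdV dW hdW) (dD_ne_zero L e dV hdV dW hdW hdV0 hdW0)
            (toHeckeCharacter L lam) (isUnitary_toHeckeCharacter L lam)
            ((isOscillatorChar_toHeckeCharacter_iff lam).mpr hlam) (TW (Fp L) a')
            (isUnit_det_TW (Fp L) a') (JW (Fp L) L a') (JW_eq (Fp L) L a'))
          p Φ)
  (ιA : (adelicGroupData (Fp L) L (IsCMField.complexConj L) N H).Adelic →*
    ↥(UnitaryGroup.adelic (Fp L) L (IsCMField.complexConj L) N (Matrix.diagonal dV)))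
  (hιAc : Continuous ιA)
  (hιAr : ∀ ⦃γ : (adelicGroupData (Fp L) L (IsCMField.complexConj L) N H).Adelic⦄,
    γ ∈ (UnitaryGroup.toAdelic (Fp L) L (IsCMField.complexConj L) N H).range →
      ιA γ ∈ (UnitaryGroup.toAdelic (Fp L) L (IsCMField.complexConj L) N (Matrix.diagonal dV)).range)
  [MeasurableSpace (↥(UnitaryGroup.adelic (Fp L) L (IsCMField.complexConj L) 1 (JW (Fp L) L a')) ⧸
    (UnitaryGroup.toAdelic (Fp L) L (IsCMField.complexConj L) 1 (JW (Fp L) L a')).range)]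
  [BorelSpace (↥(UnitaryGroup.adelic (Fp L) L (IsCMField.complexConj L) 1 (JW (Fp L) L a')) ⧸
    (UnitaryGroup.toAdelic (Fp L) L (IsCMField.complexConj L) 1 (JW (Fp L) L a')).range)]
  (μW : Measure (↥(UnitaryGroup.adelic (Fp L) L (IsCMField.complexConj L) 1 (JW (Fp L) L a')) ⧸
    (UnitaryGroup.toAdelic (Fp L) L (IsCMField.complexConj L) 1 (JW (Fp L) L a')).range)) [IsFiniteMeasure μW]
  (f : C(↥(UnitaryGroup.adelic (Fp L) L (IsCMField.complexConj L) 1 (JW (Fp L) L a')) ⧸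
    (UnitaryGroup.toAdelic (Fp L) L (IsCMField.complexConj L) 1 (JW (Fp L) L a')).range, ℂ))

include hιAc hιAr in
/-- **THE PAIRING IS `ℂ`-LINEAR IN `Φ`**: with `P Φ := doublingPairing μ (toQuotFun₂ (g ↦ Θ̃_Φ(f)(ι(ιA g₁, ιA g₂)))) w₁ w₂` on the compact `[G]`, `μ` finite,
`w₁, w₂ ∈ L¹(μ)`: `P (Φ + Ψ) = P Φ + P Ψ` and `P (c • Φ) = c · P Φ` (§1, §2, ★ `continuous_toQuotFun₂_doubledLineThetaLift`).
[cite: HarrisKudlaSweet1996, §1 proof of Lem. 1.1] [cite: Weil1964, Chap. III n° 41 Thm 6 p. 193] -/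
theorem doublingPairing_doubledLineThetaLift_add_smul
    [CompactSpace (adelicGroupData (Fp L) L (IsCMField.complexConj L) N H).automorphicQuotient]
    (μ : Measure (adelicGroupData (Fp L) L (IsCMField.complexConj L) N H).automorphicQuotient) [IsFiniteMeasure μ]
    {w₁ w₂ : (adelicGroupData (Fp L) L (IsCMField.complexConj L) N H).automorphicQuotient → ℂ}
    (hw₁ : Integrable w₁ μ) (hw₂ : Integrable w₂ μ) :
    (∀ Φ Ψ : piSchwartzBruhat (Fp L) (Fin n''),
      doublingPairing (adelicGroupData (Fp L) L (IsCMField.complexConj L) N H) μ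
          (toQuotFun₂ (adelicGroupData (Fp L) L (IsCMField.complexConj L) N H)
            (fun g => doubledLineThetaLift L e dV hdV dW hdW e₁ hdV0 hdW0 lam hlam a' hρ μW (Φ + Ψ) f (iotaV L e dV hdV dW hdW (ιA g.1, ιA g.2))))
          w₁ w₂ =
        doublingPairing (adelicGroupData (Fp L) L (IsCMField.complexConj L) N H) μ
            (toQuotFun₂ (adelicGroupData (Fp L) L (IsCMField.complexConj L) N H)
              (fun g => doubledLineThetaLift L e dV hdV dW hdW e₁ hdV0 hdW0 lam hlam a' hρ μW Φ f (iotaV L e dV hdV dW hdW (ιA g.1, ιA g.2))))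
            w₁ w₂ +
          doublingPairing (adelicGroupData (Fp L) L (IsCMField.complexConj L) N H) μ
            (toQuotFun₂ (adelicGroupData (Fp L) L (IsCMField.complexConj L) N H)
              (fun g => doubledLineThetaLift L e dV hdV dW hdW e₁ hdV0 hdW0 lam hlam a' hρ μW Ψ f (iotaV L e dV hdV dW hdW (ιA g.1, ιA g.2))))
            w₁ w₂) ∧
    ∀ (c : ℂ) (Φ : piSchwartzBruhat (Fp L) (Fin n'')),
      doublingPairing (adelicGroupData (Fp L) L (IsCMField.complexConj L) N H) μ
          (toQuotFun₂ (adelicGroupData (Fp L) L (IsCMField.complexConj L) N H)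
            (fun g => doubledLineThetaLift L e dV hdV dW hdW e₁ hdV0 hdW0 lam hlam a' hρ μW (c • Φ) f (iotaV L e dV hdV dW hdW (ιA g.1, ιA g.2))))
          w₁ w₂ =
        c * doublingPairing (adelicGroupData (Fp L) L (IsCMField.complexConj L) N H) μ
            (toQuotFun₂ (adelicGroupData (Fp L) L (IsCMField.complexConj L) N H)
              (fun g => doubledLineThetaLift L e dV hdV dW hdW e₁ hdV0 hdW0 lam hlam a' hρ μW Φ f (iotaV L e dV hdV dW hdW (ιA g.1, ιA g.2))))
            w₁ w₂ := by
  haveI : SecondCountableTopology (adelicGroupData (Fp L) L (IsCMField.complexConj L) N H).Adelic :=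
    secondCountableTopology_cmDatum_Adelic L N H
  haveI : SecondCountableTopology (adelicGroupData (Fp L) L (IsCMField.complexConj L) N H).automorphicQuotient :=
    inferInstanceAs (SecondCountableTopology ((adelicGroupData (Fp L) L (IsCMField.complexConj L) N H).Adelic ⧸
      (adelicGroupData (Fp L) L (IsCMField.complexConj L) N H).quotientSubgroup))
  have hcont := fun Φ => continuous_toQuotFun₂_doubledLineThetaLift L e H dV hdV dW hdW e₁ hdV0 hdW0 lam hlam a' hρ ιA hιAc hιAr μW f Φ
  refine ⟨fun Φ Ψ => ?_, fun c Φ => ?_⟩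
  · rw [← doublingPairing_add_of_continuous _ μ (hcont Φ) (hcont Ψ) hw₁ hw₂]
    congr 1
    funext x
    exact doubledLineThetaLift_add L e dV hdV dW hdW e₁ hdV0 hdW0 lam hlam a' hρ μW f Φ Ψ _
  · rw [← doublingPairing_const_mul]
    congr 1
    funext x
    exact doubledLineThetaLift_smul L e dV hdV dW hdW e₁ hdV0 hdW0 lam hlam a' hρ μW f c Φ _

include hιAc hιAr in
/-- **FROM A SPAN TO A GENERATOR** (organ (O45ii′) of socket #44∕45R, ED. 7): if `Φ′ ∈ span_ℂ s` and
`doublingPairing μ (toQuotFun₂ (g ↦ Θ̃_{Φ′}(f)(ι(ιA g₁, ιA g₂)))) w₁ w₂ ≠ 0` (`[G]` compact, `μ` finite, `w₁, w₂ ∈ L¹(μ)`), then the same pairing is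
non-zero at some `T ∈ s` — applied with `s` the pure tensors `Φ₁ ⊠_ι Φ₂`. [cite: HarrisKudlaSweet1996, §1 proof of Lem. 1.1] [cite: Liu2021, App. B (B.7), Lem. B.11] -/
theorem exists_mem_doublingPairing_doubledLineThetaLift_ne_zero
    [CompactSpace (adelicGroupData (Fp L) L (IsCMField.complexConj L) N H).automorphicQuotient]
    (μ : Measure (adelicGroupData (Fp L) L (IsCMField.complexConj L) N H).automorphicQuotient) [IsFiniteMeasure μ]
    {w₁ w₂ : (adelicGroupData (Fp L) L (IsCMField.complexConj L) N H).automorphicQuotient → ℂ}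
    (hw₁ : Integrable w₁ μ) (hw₂ : Integrable w₂ μ) (s : Set (piSchwartzBruhat (Fp L) (Fin n'')))
    {Φ' : piSchwartzBruhat (Fp L) (Fin n'')} (hΦ' : Φ' ∈ Submodule.span ℂ s)
    (hne : doublingPairing (adelicGroupData (Fp L) L (IsCMField.complexConj L) N H) μ
        (toQuotFun₂ (adelicGroupData (Fp L) L (IsCMField.complexConj L) N H)
          (fun g => doubledLineThetaLift L e dV hdV dW hdW e₁ hdV0 hdW0 lam hlam a' hρ μW Φ' f (iotaV L e dV hdV dW hdW (ιA g.1, ιA g.2))))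
        w₁ w₂ ≠ 0) :
    ∃ T ∈ s, doublingPairing (adelicGroupData (Fp L) L (IsCMField.complexConj L) N H) μ
        (toQuotFun₂ (adelicGroupData (Fp L) L (IsCMField.complexConj L) N H)
          (fun g => doubledLineThetaLift L e dV hdV dW hdW e₁ hdV0 hdW0 lam hlam a' hρ μW T f (iotaV L e dV hdV dW hdW (ιA g.1, ιA g.2))))
        w₁ w₂ ≠ 0 := by
  obtain ⟨hadd, hsmul⟩ := doublingPairing_doubledLineThetaLift_add_smul L e H dV hdV dW hdW e₁ hdV0 hdW0 lam hlam a' hρ ιA hιAc hιAr μW f μ hw₁ hw₂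
  exact exists_mem_of_map_span_ne_zero
    (fun Φ => doublingPairing (adelicGroupData (Fp L) L (IsCMField.complexConj L) N H) μ
        (toQuotFun₂ (adelicGroupData (Fp L) L (IsCMField.complexConj L) N H)
          (fun g => doubledLineThetaLift L e dV hdV dW hdW e₁ hdV0 hdW0 lam hlam a' hρ μW Φ f (iotaV L e dV hdV dW hdW (ιA g.1, ιA g.2))))
        w₁ w₂) hadd hsmul hΦ' hne

end Socket

end Summit.HodgeConjecture.HodgeConjecture.Cruxes.HLiu418.K2LiuDoubledLiftSpanReduction

end
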